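import Summits.QuantumFields.YangMills.Theorems.BalabanUVNodesN21ShellSplitOfRecord13CoPHStat
import Summits.QuantumFields.BalabanUV.T4Continuum.Support.ShellMeasureRootCompositionHistories

/-!
# N21 (NE7c) · THE SHELL SPLIT OF RECORD, ONE TERM AT A TIME: (M1) is additive in the measure, the block fibre law of the truncated law is the sum over the terms
# testing the cube of the per-TERM block fibre laws, hence N21's face AT `crOfRecord₁₃At K₀ jcut (shellSplitOfRecord₁₃At …)` from (M1) for ONE (2.18) history's
# frozen-exterior law on `(SU N)^{inputBlock a}` at a time — the product shape `χ_k(Ω_k(s))·slot_s` the dilation ∕ collar ENDs consume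

R134 seat `pub-ymgap-dag-n21-d` (g9), node N21 = NE7c (NOT PRINTED, NOT proved), strategy s2; lane K3⁷ `SpineGivenEndpointR13SepCoPH` (stmt-QuantumFields-20544,
`--supports … --as helper`; COUNT-NEUTRAL).  Imports `…Stat` (hence FILES 1–6 and the definition lane v1.2 `termFibreLawOfDatum₉`).

WHAT THIS FILE PROVES (theorems only; 0 `def`, 0 `sorry`).
* §1 `slotAntiConcentration_ite` ((M1) with fixed `(u, θ, ρ, D)` for an `if`-guarded measure); additivity over finite sums of measures is pub-balaban's
  `ShellMeasureRootCompositionHistories.slotAntiConcentration_finsetSum`, CITED BY NAME (imported).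
* §2 ★ `blockFibreLawOfDatum₉_eq_sum_termFibreLaw` — `blockFibreLawOfDatum₉ … t a b x = Σ_s (if a ⊂ Ω_k(s) then termFibreLawOfDatum₉ … t s b x else 0)`.
* §3 ★★ `slotAntiConcentration_blockFibreLaw_of_terms` (per-term (M1) at the terms testing `a` ⇒ (M1) for the block fibre law) · ★★★★ 
  `shellWeightBound_crOfRecord₁₃At_shellSplit_of_termFibreAC` — N21's face AT THE RECORD from: n20-d's extraction rows, signs, `Summable (D_K ρ_K)` per run, and THE
  ONE ESTIMATE per (run, K, `|t| ≤ 1`, top cube `a`, exterior field `x`, (2.18) history `s` with `a ⊂ Ω_k(s)`):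
  `SlotAntiConcentration (termFibreLawOfDatum₉ … t s (inputBlock a) x) (blockReading (cubeStat a) (inputBlock a) 1) ε_k ρ_K D_K`.

HONEST FRAMING.  By-name composition + [folklore] additivity; NO estimate; nothing of Bałaban's asserted; the displayed per-term (M1) is NOT PRINTED and NOT proved; A6:
the zero width is the junk instance; K0⁷ open; NE7c NOT proved; N21 NOT discharged; K3⁷ NOT claimed; counts UNMOVED (typed 28∕28 · discharged 5∕27); never a count claim.
No `instance`, no `notation`, no `def`.  One finite four-torus programme at fixed `ε` — NOT ℝ⁴, NOT OS, NOT a mass gap, NOT the Clay problem.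
-/

noncomputable section

open scoped BigOperators ENNReal
open Finset MeasureTheory

namespace Summit.QuantumFields.YangMills.Theorems.N21ShellSplitOfRecord13CoPH

open Literature.MathematicalPhysics.QuantumFieldTheory.Balaban1983to89
open Literature.MathematicalPhysics.QuantumFieldTheory.Balaban1983to89.T4Continuum
open Literature.MathematicalPhysics.QuantumFieldTheory.Balaban1983to89.Node00
open T4ShellMeasure (SlotAntiConcentration)
open T4IndicatorShell (ShellWeightBound)
open YMDAG.UVSplit (crOfRecord₁₃At ShellSplit₁₃CoPH runA₁₃ runB₁₃ histA₁₃ histB₁₃)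
open Summit.QuantumFields.YangMills.BalabanUVNodes.N19MGFRoadLiveSelectorTower (measurable_dressedSlotsOfDatum₉)
open Summit.QuantumFields.YangMills.BalabanUVNodes.N19MGFFormAtRecord (wOfRecord₉_nonneg)
open Summit.QuantumFields.BalabanUV.T4Continuum.ShellMeasureRootCompositionHistories (slotAntiConcentration_finsetSum)

/-! ## §1 (M1) for an `if`-guarded measure (additivity is cited) -/

section Additive

variable {Ω : Type*} [MeasurableSpace Ω] {u : Ω → ℝ} {θ ρ D : ℝ}

/-- (M1) for an `if`-guarded measure from (M1) on the `then` branch. [folklore] -/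
theorem slotAntiConcentration_ite {P : Prop} [Decidable P] {μ : Measure Ω} (h : P → SlotAntiConcentration μ u θ ρ D) :
    SlotAntiConcentration (if P then μ else 0) u θ ρ D := by
  split_ifs with hP
  · exact h hP
  · unfold SlotAntiConcentration; simp

end Additive

/-! ## §2 The block fibre law of the truncated law is the sum of the per-term block fibre laws -/

section TermSum

variable (F : T4Family) (N : ℕ) [NeZero N] (ϑ : Stage9Params F N) (D : FiniteEpsData F (SU N)) (g₀ : ℕ → ℝ) (os : List (ULoop F))
  (p : B12.RunParams) (g : ℕ → ℝ) (k : ℕ)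

/-- ★ **THE BLOCK FIBRE LAW = Σ OVER THE TERMS TESTING `a` OF THE PER-TERM BLOCK FIBRE LAWS** (the summed density is the sum of the per-term densities;
`withDensity` of a finite sum, by `Measure.ext` + `lintegral_finsetSum`; (H-U), (H-ζ), `D.AvgMeasurable` for measurability). [bookkeeping] -/
theorem blockFibreLawOfDatum₉_eq_sum_termFibreLaw (hU : LocalBgMeasurable F N ϑ.ν) (hζm : ZetaMeasurable F N ϑ.ζ) (hD : D.AvgMeasurable) (t : ℝ)
    (a : ↥(cubeIndices (F.P p.K) (cubeSide (F.P p.K).L ϑ.ν.M₂ (RkOfRecord (F.P p.K).L ϑ.ν.r (g k)) k))) (b : Finset (PBond (F.P p.K) k))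
    (x : GaugeField (F.P p.K) k (SU N)) :
    blockFibreLawOfDatum₉ F N ϑ D g₀ os p g k t a b x =
      ∑ s : SeqOfRecord F ϑ.ν ϑ.τ9.M g p.K k, if a ∈ cubesOfSeq F ϑ.ν ϑ.τ9.M g p.K k s then termFibreLawOfDatum₉ F N ϑ D g₀ os p g k t s b x else 0 := by
  letI := Classical.decEq (PBond (F.P p.K) k)
  have hχm : ∀ k s, Measurable (chiSeqOfRecord F N ϑ.ν ϑ.τ9.M g p.K k s) := fun k s => measurable_chiSeqOfRecord_of_localBg hU ϑ.τ9.M g p.K k s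
  have hwm : ∀ k s', Measurable (fun z : GaugeField (F.P p.K) (k + 1) (SU N) × GaugeField (F.P p.K) k (SU N) => wOfRecord₉ F N ϑ p g k s' z.2 z.1) :=
    fun k s' => measurable_wOfRecord_of_localBg hU ϑ.τ9.M ϑ.A₁ hζm p g k s'
  have hsl := measurable_dressedSlotsOfDatum₉ F N ϑ D g₀ os p g hD hwm hχm t k
  have hterm : ∀ s : SeqOfRecord F ϑ.ν ϑ.τ9.M g p.K k, Measurable (fun y : ↥b → SU N =>
      ENNReal.ofReal (chiSeqOfRecord F N ϑ.ν ϑ.τ9.M g p.K k s (Function.updateFinset x b y) *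
        dressedSlotsOfDatum₉ F N ϑ D g₀ os t p g k s (Function.updateFinset x b y))) :=
    fun s => (((hχm k s).mul (hsl s)).comp measurable_updateFinset).ennreal_ofReal
  refine Measure.ext fun E hE => ?_
  show ((Measure.pi fun _ : ↥b => (HaarData.haar : Measure (SU N))).withDensity
      (fun y => cubeDensityOfDatum₉ F N ϑ D g₀ os p g k t a (Function.updateFinset x b y))) E = _
  rw [withDensity_apply _ hE, Measure.finsetSum_apply]
  unfold cubeDensityOfDatum₉
  rw [lintegral_finsetSum _ fun s _ => ?_]
  · refine Finset.sum_congr rfl fun s _ => ?_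
    split_ifs with h
    · show _ = ((Measure.pi fun _ : ↥b => (HaarData.haar : Measure (SU N))).withDensity _) E
      rw [withDensity_apply _ hE]
    · simp
  · split_ifs
    · exact hterm s
    · exact measurable_const

/-! ## §3 Per-term (M1) ⇒ (M1) for the block fibre law ⇒ N21's face at the record -/

/-- ★★ **PER-TERM (M1) AT THE TERMS TESTING `a` ⇒ (M1) FOR THE BLOCK FIBRE LAW** (same statistic, letters, constant; §1 additivity over §2's sum). [bookkeeping] -/
theorem slotAntiConcentration_blockFibreLaw_of_terms (hU : LocalBgMeasurable F N ϑ.ν) (hζm : ZetaMeasurable F N ϑ.ζ) (hD : D.AvgMeasurable) (t : ℝ)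
    (a : ↥(cubeIndices (F.P p.K) (cubeSide (F.P p.K).L ϑ.ν.M₂ (RkOfRecord (F.P p.K).L ϑ.ν.r (g k)) k))) (b : Finset (PBond (F.P p.K) k))
    (x : GaugeField (F.P p.K) k (SU N)) {v : (↥b → SU N) → ℝ} {θ ρ Dc : ℝ}
    (h : ∀ s : SeqOfRecord F ϑ.ν ϑ.τ9.M g p.K k, a ∈ cubesOfSeq F ϑ.ν ϑ.τ9.M g p.K k s →
      SlotAntiConcentration (termFibreLawOfDatum₉ F N ϑ D g₀ os p g k t s b x) v θ ρ Dc) :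
    SlotAntiConcentration (blockFibreLawOfDatum₉ F N ϑ D g₀ os p g k t a b x) v θ ρ Dc := by
  rw [blockFibreLawOfDatum₉_eq_sum_termFibreLaw F N ϑ D g₀ os p g k hU hζm hD t a b x]
  exact slotAntiConcentration_finsetSum _ _ fun s _ => slotAntiConcentration_ite (h s)

end TermSum

section TheEnd

variable {F : T4Family} {N : ℕ} [NeZero N]

/-- ★★★★ **N21 AT THE SPINE READING OF RECORD WITH ITS SHELL SPLIT — FROM PER-TERM (M1).**  On the live-selector line, under n20-d's extraction rows (`hsel`, (H-U), (H-ζ),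
`0 ≤ ζ`), width letters `0 ≤ ρ`, constants `0 ≤ D`, `Summable (D_K ρ_K)` per run, and — THE ONE DISPLAYED ESTIMATE — for every (run, K, `|t| ≤ 1`, top cube `a`,
exterior field `x`, (2.18) history `s` of the run with `a ⊂ Ω_k(s)`):
`SlotAntiConcentration (termFibreLawOfDatum₉ … t s (inputBlock a) x) (blockReading (cubeStat a) (inputBlock a) 1) ε_k ρ_K D_K` — anti-concentration, at relative scale `ρ_K`
below `ε_k`, of the cube statistic (one function of the block variables) under ONE history's frozen-exterior law `χ_k(Ω_k(s))·slot_s · dHaar^{inputBlock a}` — THEN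
`ShellWeightBound` AT `crOfRecord₁₃At K₀ jcut (shellSplitOfRecord₁₃At N K₀ ρA ρB)`. [bookkeeping] -/
theorem shellWeightBound_crOfRecord₁₃At_shellSplit_of_termFibreAC (K₀ : ℕ) (jcut : ℕ → ℕ) (ρA ρB : WidthLetter₁₃CoPH N) (θ : Stage13HParams F N)
    (hP : θ.Provisos₁₃CoPH F N) (g₀ : ℕ → ℝ) (os : List (ULoop F)) (E : B12.RunParams → ℝ)
    (hsel : θ.ppSel = ppSelLiveOfRecord F N θ.ν θ.τ9 E (wOfRecord₉ F N θ.toStage9Params))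
    (hU : LocalBgMeasurable F N θ.ν) (hζm : ZetaMeasurable F N θ.ζ) (hζ0 : ∀ p g k s Pl Ql RS U V', 0 ≤ θ.ζ p g k s Pl Ql RS U V')
    {DA DB : ℕ → ℝ} (hρA : ∀ K, 0 ≤ ρA F θ hP g₀ os K) (hDA : ∀ K, 0 ≤ DA K) (hρB : ∀ K, 0 ≤ ρB F θ hP g₀ os K) (hDB : ∀ K, 0 ≤ DB K)
    (hsA : Summable (fun K => DA K * ρA F θ hP g₀ os K)) (hsB : Summable (fun K => DB K * ρB F θ hP g₀ os K))
    (htermA : ∀ (K : ℕ) (t : ℝ), |t| ≤ 1 →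
      ∀ (a : ↥(cubeIndices (F.P (K₀ + K)) (cubeSide (F.P (K₀ + K)).L θ.ν.M₂ (RkOfRecord (F.P (K₀ + K)).L θ.ν.r (histA₁₃ θ K₀ g₀ K (K₀ + K))) (K₀ + K))))
        (x : GaugeField (F.P (K₀ + K)) (K₀ + K) (SU N)) (s : SeqOfRecord F θ.ν θ.τ9.M (histA₁₃ θ K₀ g₀ K) (K₀ + K) (K₀ + K)),
        a ∈ cubesOfSeq F θ.ν θ.τ9.M (histA₁₃ θ K₀ g₀ K) (K₀ + K) (K₀ + K) s →
        SlotAntiConcentration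
          (termFibreLawOfDatum₉ F N θ.toStage9Params (datumOfRecord₁₃CoPH F N θ hP) g₀ os (runA₁₃ F K₀ g₀ K) (histA₁₃ θ K₀ g₀ K) (K₀ + K) t s
            (inputBlock F θ.ν (histA₁₃ θ K₀ g₀ K) a) x)
          (blockReading N (cubeStat F N θ.ν (histA₁₃ θ K₀ g₀ K) (Kc := K₀ + K) (k := K₀ + K) a) (inputBlock F θ.ν (histA₁₃ θ K₀ g₀ K) a) (fun _ => 1))
          (epsOfRecord θ.ν (histA₁₃ θ K₀ g₀ K) (K₀ + K)) (ρA F θ hP g₀ os K) (DA K))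
    (htermB : ∀ (K : ℕ) (t : ℝ), |t| ≤ 1 →
      ∀ (a : ↥(cubeIndices (F.P (K₀ + K + 1)) (cubeSide (F.P (K₀ + K + 1)).L θ.ν.M₂
          (RkOfRecord (F.P (K₀ + K + 1)).L θ.ν.r (histB₁₃ θ K₀ g₀ K (K₀ + K + 1))) (K₀ + K + 1))))
        (x : GaugeField (F.P (K₀ + K + 1)) (K₀ + K + 1) (SU N)) (s' : SeqOfRecord F θ.ν θ.τ9.M (histB₁₃ θ K₀ g₀ K) (K₀ + K + 1) (K₀ + K + 1)),
        a ∈ cubesOfSeq F θ.ν θ.τ9.M (histB₁₃ θ K₀ g₀ K) (K₀ + K + 1) (K₀ + K + 1) s' →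
        SlotAntiConcentration
          (termFibreLawOfDatum₉ F N θ.toStage9Params (datumOfRecord₁₃CoPH F N θ hP) g₀ os (runB₁₃ F K₀ g₀ K) (histB₁₃ θ K₀ g₀ K) (K₀ + K + 1) t s'
            (inputBlock F θ.ν (histB₁₃ θ K₀ g₀ K) a) x)
          (blockReading N (cubeStat F N θ.ν (histB₁₃ θ K₀ g₀ K) (Kc := K₀ + K + 1) (k := K₀ + K + 1) a) (inputBlock F θ.ν (histB₁₃ θ K₀ g₀ K) a) (fun _ => 1))
          (epsOfRecord θ.ν (histB₁₃ θ K₀ g₀ K) (K₀ + K + 1)) (ρB F θ hP g₀ os K) (DB K)) :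
    ShellWeightBound (crOfRecord₁₃At K₀ jcut (shellSplitOfRecord₁₃At N K₀ ρA ρB) F θ hP g₀ os).l₀
      (crOfRecord₁₃At K₀ jcut (shellSplitOfRecord₁₃At N K₀ ρA ρB) F θ hP g₀ os).T (crOfRecord₁₃At K₀ jcut (shellSplitOfRecord₁₃At N K₀ ρA ρB) F θ hP g₀ os).A
      (crOfRecord₁₃At K₀ jcut (shellSplitOfRecord₁₃At N K₀ ρA ρB) F θ hP g₀ os).B (crOfRecord₁₃At K₀ jcut (shellSplitOfRecord₁₃At N K₀ ρA ρB) F θ hP g₀ os).shA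
      (crOfRecord₁₃At K₀ jcut (shellSplitOfRecord₁₃At N K₀ ρA ρB) F θ hP g₀ os).shB (crOfRecord₁₃At K₀ jcut (shellSplitOfRecord₁₃At N K₀ ρA ρB) F θ hP g₀ os).Wsh := by
  have hD : (datumOfRecord₁₃CoPH F N θ hP).AvgMeasurable := (isPrintedAveraged_datumOfRecord₁₃CoPH F N θ hP).avgMeasurable
  refine shellWeightBound_crOfRecord₁₃At_shellSplit_of_blockFibreAC K₀ jcut ρA ρB θ hP g₀ os E hsel hU hζm hζ0 hρA hDA hρB hDB hsA hsB
    (fun K t ht a x => ?_) (fun K t ht a x => ?_)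
  · -- run A: additivity over the terms testing `a` (the reading through `1` is the one `…_of_blockFibreAC` asks for)
    exact slotAntiConcentration_blockFibreLaw_of_terms F N θ.toStage9Params (datumOfRecord₁₃CoPH F N θ hP) g₀ os (runA₁₃ F K₀ g₀ K) (histA₁₃ θ K₀ g₀ K)
      (K₀ + K) hU hζm hD t a _ x fun s hs => htermA K t ht a x s hs
  · exact slotAntiConcentration_blockFibreLaw_of_terms F N θ.toStage9Params (datumOfRecord₁₃CoPH F N θ hP) g₀ os (runB₁₃ F K₀ g₀ K) (histB₁₃ θ K₀ g₀ K)
      (K₀ + K + 1) hU hζm hD t a _ x fun s' hs' => htermB K t ht a x s' hs'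

end TheEnd

end Summit.QuantumFields.YangMills.Theorems.N21ShellSplitOfRecord13CoPH

end
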